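import Summits.SmoothPoincare4.SmoothPoincare4.Theorems.SblfDescentRungOneHelperFoldNFDescend
import Literature.Geometry.Manifold.InjOnLocalDiffeomorphInverse
import Mathlib.Geometry.Manifold.Instances.Sphere
import HarnessLib

/-!
# Morse–Bott charts from a Morse–Bott tube

Auxiliary file of stub `helper_sliceGluing_bottRecognition` (fibred Morse–Bott recognition of the
polar tube), line `Sketch`, crux `SblfDescent.RungOne`: the bridge from the tube layer
(`helper_bott_tube`) to the field layer (`helper_bott_field`).

(Crux item stmt-SmoothPoincare4-18531; skeleton `Cruxes/RungOne/Lines/Sketch.lean`.)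

A Morse–Bott tube `ν : 𝕊¹ × B(0, ε) → X` (smooth, injective, open image, bijective differentials)
with `F (ν (u, y)) = b - ‖y‖²` and `β (ν (u, y)) = u` gives, about every point of its image, a
chart `τ = (ang × id) ∘ ν⁻¹ : X ⊇ O → ℝ × ℝ³` (`ang` one of the two smooth angle functions
`angA`, `angB` of `TorusCoordinates.lean`) with bijective differentials in which
`F = b - ‖pr₂ τ‖²` and `β = (cos 2π pr₁ τ, sin 2π pr₁ τ)` (`BottCharts.exists_chart`): the
inverse `ν⁻¹` is smooth with bijective differentials by the inverse function theorem
(`Literature.Geometry.Manifold.contMDiffOn_invFunOn_of_bijective_mfderiv`), and `τ` has the smooth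
local left inverse `ν ∘ (circlePt × id)`.

## References

* J. M. Lee, *Introduction to Smooth Manifolds*, 2nd ed. (2013), Thm. 4.5. [LeeSmoothManifolds2013]
-/

set_option linter.dupNamespace false

noncomputable section

open scoped Manifold ContDiff Topology
open Set Function Filter Metric Literature.Topology.FourManifolds

namespace Summit.SmoothPoincare4.SmoothPoincare4.Cruxes.RungOne.Sketch

namespace BottCharts

variable {X : Type} [TopologicalSpace X] [ChartedSpace (EuclideanSpace ℝ (Fin 4)) X]
  [IsManifold (𝓡 4) ∞ X]

omit [IsManifold (𝓡 4) ∞ X] in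
/-- An injective differential of a map `X⁴ → ℝ × ℝ³` is bijective (equal dimensions). [folklore] -/
theorem bijective_of_injective {τ : X → ℝ × EuclideanSpace ℝ (Fin 3)} {x : X}
    (h : Injective (mfderiv (𝓡 4) 𝓘(ℝ, ℝ × EuclideanSpace ℝ (Fin 3)) τ x)) :
    Bijective (mfderiv (𝓡 4) 𝓘(ℝ, ℝ × EuclideanSpace ℝ (Fin 3)) τ x) := by
  haveI : FiniteDimensional ℝ (TangentSpace (𝓡 4) x) :=
    inferInstanceAs (FiniteDimensional ℝ (EuclideanSpace ℝ (Fin 4)))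
  haveI : FiniteDimensional ℝ (TangentSpace 𝓘(ℝ, ℝ × EuclideanSpace ℝ (Fin 3)) (τ x)) :=
    inferInstanceAs (FiniteDimensional ℝ (ℝ × EuclideanSpace ℝ (Fin 3)))
  have hdim : Module.finrank ℝ (TangentSpace (𝓡 4) x) =
      Module.finrank ℝ (TangentSpace 𝓘(ℝ, ℝ × EuclideanSpace ℝ (Fin 3)) (τ x)) := by
    show Module.finrank ℝ (EuclideanSpace ℝ (Fin 4)) = Module.finrank ℝ (ℝ × EuclideanSpace ℝ (Fin 3))
    rw [Module.finrank_prod]; simp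
  exact ⟨h, (LinearMap.injective_iff_surjective_of_finrank_eq_finrank hdim
    (f := (mfderiv (𝓡 4) 𝓘(ℝ, ℝ × EuclideanSpace ℝ (Fin 3)) τ x).toLinearMap)).1 h⟩

/-- **A smooth angle function about any point of the circle**: `ang : 𝕊¹ → ℝ`, `C^∞` on an open
set `A ∋ u₀`, with `circlePt ∘ ang = id`. [folklore] -/
theorem exists_angle (u₀ : Metric.sphere (0 : EuclideanSpace ℝ (Fin 2)) 1) :
    ∃ (ang : Metric.sphere (0 : EuclideanSpace ℝ (Fin 2)) 1 → ℝ) (A : Set (Metric.sphere (0 : EuclideanSpace ℝ (Fin 2)) 1)),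
      IsOpen A ∧ u₀ ∈ A ∧ (∀ v ∈ A, ContMDiffAt (𝓡 1) 𝓘(ℝ, ℝ) ∞ ang v) ∧ ∀ v, circlePt (ang v) = v := by
  by_cases h : u₀ = ptA
  · refine ⟨angB, {ptB}ᶜ, isOpen_compl_singleton, ?_, fun v hv => contMDiffAt_angB hv, circlePt_angB⟩
    rw [h]; exact ptA_ne_ptB
  · exact ⟨angA, {ptA}ᶜ, isOpen_compl_singleton, h, fun v hv => contMDiffAt_angA hv, circlePt_angA⟩

/-- **Morse–Bott charts from a Morse–Bott tube** (see the module docstring).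
[cite: LeeSmoothManifolds2013, Thm. 4.5] -/
theorem exists_chart {F : X → ℝ} {β : X → EuclideanSpace ℝ (Fin 2)} {b ε : ℝ}
    {ν : (Metric.sphere (0 : EuclideanSpace ℝ (Fin 2)) 1) × EuclideanSpace ℝ (Fin 3) → X}
    (hνs : ContMDiffOn ((𝓡 1).prod 𝓘(ℝ, EuclideanSpace ℝ (Fin 3))) (𝓡 4) ∞ ν (univ ×ˢ ball 0 ε))
    (hνinj : InjOn ν (univ ×ˢ ball 0 ε)) (hνopen : IsOpen (ν '' (univ ×ˢ ball 0 ε)))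
    (hνbij : ∀ p ∈ univ ×ˢ ball (0 : EuclideanSpace ℝ (Fin 3)) ε,
      Bijective (mfderiv ((𝓡 1).prod 𝓘(ℝ, EuclideanSpace ℝ (Fin 3))) (𝓡 4) ν p))
    (hνF : ∀ (u : Metric.sphere (0 : EuclideanSpace ℝ (Fin 2)) 1) (y : EuclideanSpace ℝ (Fin 3)),
      ‖y‖ < ε → F (ν (u, y)) = b - ‖y‖ ^ 2 ∧ β (ν (u, y)) = (u : EuclideanSpace ℝ (Fin 2)))
    {x₀ : X} (hx₀ : x₀ ∈ ν '' (univ ×ˢ ball 0 ε)) :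
    ∃ (O : Set X) (τ : X → ℝ × EuclideanSpace ℝ (Fin 3)), IsOpen O ∧ x₀ ∈ O ∧
      ContMDiffOn (𝓡 4) 𝓘(ℝ, ℝ × EuclideanSpace ℝ (Fin 3)) ∞ τ O ∧
      (∀ x ∈ O, Bijective (mfderiv (𝓡 4) 𝓘(ℝ, ℝ × EuclideanSpace ℝ (Fin 3)) τ x)) ∧
      (∀ x ∈ O, F x = b - ‖(τ x).2‖ ^ 2) ∧
      ∀ x ∈ O, β x 0 = Real.cos (2 * Real.pi * (τ x).1) ∧ β x 1 = Real.sin (2 * Real.pi * (τ x).1) := by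
  haveI : Nonempty ((Metric.sphere (0 : EuclideanSpace ℝ (Fin 2)) 1) × EuclideanSpace ℝ (Fin 3)) := ⟨(ptA, 0)⟩
  haveI : Fact (Module.finrank ℝ (EuclideanSpace ℝ (Fin 2)) = 1 + 1) := ⟨by simp⟩
  set S : Set ((Metric.sphere (0 : EuclideanSpace ℝ (Fin 2)) 1) × EuclideanSpace ℝ (Fin 3)) := univ ×ˢ ball 0 ε with hS
  have hSo : IsOpen S := isOpen_univ.prod isOpen_ball
  set νinv : X → (Metric.sphere (0 : EuclideanSpace ℝ (Fin 2)) 1) × EuclideanSpace ℝ (Fin 3) := invFunOn ν S with hνinv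
  have hνinvs : ContMDiffOn (𝓡 4) ((𝓡 1).prod 𝓘(ℝ, EuclideanSpace ℝ (Fin 3))) ∞ νinv (ν '' S) :=
    Literature.Geometry.Manifold.contMDiffOn_invFunOn_of_bijective_mfderiv hSo hνs hνinj hνbij
  have hνinv_mem : ∀ x ∈ ν '' S, νinv x ∈ S := fun x hx => Literature.Geometry.Manifold.invFunOn_mem hx
  have hν_νinv : ∀ x ∈ ν '' S, ν (νinv x) = x := fun x hx => Literature.Geometry.Manifold.apply_invFunOn hx
  -- the angle function about `(νinv x₀).1`
  obtain ⟨ang, A, hAo, hu₀A, hang, hsec⟩ := exists_angle (νinv x₀).1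
  set O : Set X := ν '' S ∩ νinv ⁻¹' (Prod.fst ⁻¹' A) with hO
  have hOo : IsOpen O := hνinvs.continuousOn.isOpen_inter_preimage hνopen (hAo.preimage continuous_fst)
  set τ : X → ℝ × EuclideanSpace ℝ (Fin 3) := fun x => (ang (νinv x).1, (νinv x).2) with hτ
  have hx₀O : x₀ ∈ O := ⟨hx₀, hu₀A⟩
  -- smoothness
  have hG : ∀ p : (Metric.sphere (0 : EuclideanSpace ℝ (Fin 2)) 1) × EuclideanSpace ℝ (Fin 3), p.1 ∈ A →
      ContMDiffAt ((𝓡 1).prod 𝓘(ℝ, EuclideanSpace ℝ (Fin 3))) 𝓘(ℝ, ℝ × EuclideanSpace ℝ (Fin 3)) ∞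
        (fun p : (Metric.sphere (0 : EuclideanSpace ℝ (Fin 2)) 1) × EuclideanSpace ℝ (Fin 3) =>
          ((ang p.1, p.2) : ℝ × EuclideanSpace ℝ (Fin 3))) p := fun p hp =>
    ((hang _ hp).comp p contMDiffAt_fst).prodMk_space contMDiffAt_snd
  have hτat : ∀ x ∈ O, ContMDiffAt (𝓡 4) 𝓘(ℝ, ℝ × EuclideanSpace ℝ (Fin 3)) ∞ τ x := fun x hx =>
    (hG _ hx.2).comp x (hνinvs.contMDiffAt (hνopen.mem_nhds hx.1))
  have hτs : ContMDiffOn (𝓡 4) 𝓘(ℝ, ℝ × EuclideanSpace ℝ (Fin 3)) ∞ τ O := fun x hx => (hτat x hx).contMDiffWithinAt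
  -- the smooth left inverse `ν ∘ (circlePt × id)`
  have hleft : ∀ x ∈ ν '' S, ν (circlePt (τ x).1, (τ x).2) = x := fun x hx => by
    simp only [hτ, hsec, Prod.mk.eta]
    exact hν_νinv x hx
  refine ⟨O, τ, hOo, hx₀O, hτs, fun x hx => ?_, fun x hx => ?_, fun x hx => ?_⟩
  · -- bijective differential
    refine bijective_of_injective ?_
    have hB : ContMDiffAt 𝓘(ℝ, ℝ × EuclideanSpace ℝ (Fin 3)) (𝓡 4) ∞
        (ν ∘ fun q : ℝ × EuclideanSpace ℝ (Fin 3) => ((circlePt q.1, q.2) :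
          (Metric.sphere (0 : EuclideanSpace ℝ (Fin 2)) 1) × EuclideanSpace ℝ (Fin 3))) (τ x) := by
      refine ContMDiffAt.comp (τ x) ?_ (contMDiff_circlePt_prod (τ x))
      have hmem : ((circlePt (τ x).1, (τ x).2) : (Metric.sphere (0 : EuclideanSpace ℝ (Fin 2)) 1) × EuclideanSpace ℝ (Fin 3)) ∈ S := by
        simp only [hτ, hsec, Prod.mk.eta]; exact hνinv_mem x hx.1
      exact hνs.contMDiffAt (hSo.mem_nhds hmem)
    refine mfderiv_injective_of_leftInverse (hτat x hx) hB ?_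
    filter_upwards [hνopen.mem_nhds hx.1] with x' hx'
    exact hleft x' hx'
  · -- the level
    have h := (hνF (νinv x).1 (νinv x).2 (mem_ball_zero_iff.1 (hνinv_mem x hx.1).2)).1
    rw [Prod.mk.eta, hν_νinv x hx.1] at h
    exact h
  · -- the angle
    have h := (hνF (νinv x).1 (νinv x).2 (mem_ball_zero_iff.1 (hνinv_mem x hx.1).2)).2
    rw [Prod.mk.eta, hν_νinv x hx.1] at h
    have hu : ((νinv x).1 : EuclideanSpace ℝ (Fin 2)) = (circlePt (ang (νinv x).1) : EuclideanSpace ℝ (Fin 2)) := by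
      rw [hsec]
    rw [h, hu]
    exact ⟨circlePt_apply_zero _, circlePt_apply_one _⟩

end BottCharts

end Summit.SmoothPoincare4.SmoothPoincare4.Cruxes.RungOne.Sketch

end
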